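/-
Copyright: the b2b-balaban cell (near-miss cell 7), T⁴-continuum fan-out; row NE7b ROUND-2 swarm, seat
t4-ne7b-formalise-leaf-04 (gen 3) — row S6g′(a) pt 2-LV «THE LAW AT LEVELS», file 1∕2 (journal CLAIM l.9299; the
levelled twin of this lineage's `HistoryZoneEvolve` p212708 on leaf-07 g2's levelled reading `ZoneReadingD`).
Released under the licence of the surrounding project.
-/
import Summits.QuantumFields.BalabanUV.T4Continuum.Support.HistoryZoneEvolve
import Summits.QuantumFields.BalabanUV.T4Continuum.Support.HistoryZonesDrops

/-!
# Zone evolution AT LEVELS and the ancestor decomposition of a levelled tolerant zone (row S6g′(a) pt 2-LV, file 1∕2)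

Summits-side support leaf of the T⁴-continuum cell (rung (B)+1 on a FINITE torus only; NOT infinite volume, NOT the
mass gap, NOT the Clay statement; NOT a proof of the spine estimate NE7b).  Row NE7b, route «COUNT», row S6g′
«MASS-BASED SIBLING COUNT» (R-OWNER-22-12 (2)), step (a) = the CARDINALITY LAW of the zone reading, here WITH
WINDOW-DROP STEPS: the set-and-tree half of the law's proof redone on leaf-07 g2's LEVELLED tolerant reading
`HistoryZones.ZoneReadingD sh n L K lv Cb c G zone` (row S6f, `Support/HistoryZonesDrops`), in which the cube lattice
of step `t` is the level-`lv t` blocking of the cutoff torus and one step blocks by `L^{lv (t+1) − lv t} ∈ {1, L}`.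
The drop-free file is `Support/HistoryZoneEvolve` (`lv = id`); the law at levels is file 2∕2
`Support/HistoryZoneMassLawLevels`.  [folklore] finite geometry + structural recursion on OUR carriers, with
leaf-10 g2's `HistoryZoneMass` (`blocks_thickT_subset`, `thickT_thickT_subset`, `thickT_mono_radius`,
`card_thickT_le`), leaf-07 g2's `HistoryZones.{LevelFn, blocks_blocks, blocks_one, ZoneReadingD}` and this lineage's
`HistoryZoneEvolve.{cth, parts, ustart, lunion, …}` BY NAME; nothing is quoted from print, nothing printed is
asserted, no `[cite:]` tag, no `Prop`-valued fact minted; constants symbolic (trigger c2∕c6).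

WHAT.  §1 `sideD n L K lv t = n·L^{K − lv t}` (the level-`lv t` torus side), `sideD_add` (for a level function and
`u + k ≤ K`: `sideD u = sideD (u+k)·L^{lv (u+k) − lv u}`); **`evolveD n L K lv c u k S`** = the `k`-fold LEVELLED tolerant
evolution of a set from step `u` (block by `L^{lv (u+j+1) − lv (u+j)}`, thicken by `c` on the next level torus):
`evolveD_empty`, `evolveD_union`, `evolveD_mono`, **`evolveD_add`**, `inRange_evolveD`; the LEVEL-PATTERN-FREE collapsed
radius is the drop-free `cth` at `L = 1` (`cth_one : cth c 1 k = k·(c+1)` — at a plateau step the blocking is by `1`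
and the thickening radius does not contract, so the majorant valid for every pattern of isolated plateaus is the one
with no contraction at all) and **`evolveD_subset_thickT_blocks`**: `k` levelled tolerant steps lie in ONE blocking by
`L^{lv (u+k) − lv u}` and ONE thickening by `cth c 1 k`; hence **`card_evolveD_le`**:
`#evolveD u k S ≤ (2·cth c 1 k + 1)^d·#blocks (L^{lv (u+k) − lv u}) S`.  §2 for a tagged genealogy read by
`ZoneReadingD sh n L K lv Cb c G zone`: `zone_subset_evolveD`, `evolve_pieceD` and **`zone_subset_partsD`** — the
ancestor decomposition of `HistoryZoneEvolve.zone_subset_parts` verbatim at levels, over the SAME pieces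
`HistoryZoneEvolve.parts sh t₀ X` and start times `ustart` (chronological reading, `X` formed by `t`, `t₀ ≤ t + 1`):
`zone t X ⊆ ⋃_{p ∈ parts t₀ X} evolveD (ustart p) (t − ustart p) (zone (ustart p) p)`.  §3 sanity (decided).

HONEST: bookkeeping on OUR reading; NE7b NOT proved; spine 0∕9.  HONEST DEPENDENCY (cell): continuum YM on T⁴ ⇐
BetaPertH ∧ nine spine estimates (0/9 proved); BetaPertH ⇐ (D1) ∧ (D4) ∧ CAP+tail; G-an2-4 gates asym, D1 and
NE2/3/4.  This file changes none of it.
-/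

open Finset
open Literature.MathematicalPhysics.QuantumFieldTheory.Balaban1983to89
open T4PersistenceDictionary T4PartnerMultiplicity
open Summit.QuantumFields.BalabanUV.T4Continuum.PlacementSkeleton
open Summit.QuantumFields.BalabanUV.T4Continuum.Crowding
open Summit.QuantumFields.BalabanUV.T4Continuum.ZoneSkeleton
open Summit.QuantumFields.BalabanUV.T4Continuum.ZoneTorus
open Summit.QuantumFields.BalabanUV.T4Continuum.HistoryZones
open Summit.QuantumFields.BalabanUV.T4Continuum.HistoryZoneMass
open Summit.QuantumFields.BalabanUV.T4Continuum.HistoryZoneEvolve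

namespace Summit.QuantumFields.BalabanUV.T4Continuum.HistoryZoneEvolveLevels

noncomputable section

variable {d : ℕ}

/-! ## §1 The levelled tolerant evolution of a set over `k` steps -/

section Evolve

/-- the level-`lv t` torus side at step `t`: `n·L^{K − lv t}` [folklore] -/
def sideD (n L K : ℕ) (lv : ℕ → ℕ) (t : ℕ) : ℕ := n * L ^ (K - lv t)

/-- for a level function, `sideD` `k` steps earlier is `L^{lv (u+k) − lv u}` times `sideD` (`u + k ≤ K`) [folklore] -/
theorem sideD_add {n L K : ℕ} {lv : ℕ → ℕ} (hlv : LevelFn K lv) {u k : ℕ} (h : u + k ≤ K) :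
    sideD n L K lv u = sideD n L K lv (u + k) * L ^ (lv (u + k) - lv u) := by
  have h1 : lv (u + k) ≤ K := hlv.le_K _ h
  have h2 : lv u ≤ lv (u + k) := hlv.monotone (Nat.le_add_right u k)
  rw [sideD, sideD, mul_assoc, ← pow_add]
  congr 2; omega

/-- **THE `k`-FOLD LEVELLED TOLERANT EVOLUTION** of a set from step `u`: at each step, block by
`L^{lv (next) − lv (current)}` and thicken by `c` on the next level torus. [folklore] -/
def evolveD (n L K : ℕ) (lv : ℕ → ℕ) (c u : ℕ) : ℕ → Finset (Fin d → ℕ) → Finset (Fin d → ℕ)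
  | 0, S => S
  | k + 1, S => thickT (sideD n L K lv (u + k + 1)) c
      (blocks (L ^ (lv (u + k + 1) - lv (u + k))) (evolveD n L K lv c u k S))

variable {n L K c : ℕ} {lv : ℕ → ℕ}

/-- nothing evolves from nothing [folklore] -/
theorem evolveD_empty (u : ℕ) : ∀ k : ℕ, evolveD n L K lv c u k (∅ : Finset (Fin d → ℕ)) = ∅
  | 0 => rfl
  | k + 1 => by
      show thickT _ c (blocks _ (evolveD n L K lv c u k ∅)) = ∅
      rw [evolveD_empty u k, blocks, image_empty]
      ext u; simp [mem_thickT]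

/-- evolution distributes over unions [folklore] -/
theorem evolveD_union (u : ℕ) : ∀ (k : ℕ) (S T : Finset (Fin d → ℕ)),
    evolveD n L K lv c u k (S ∪ T) = evolveD n L K lv c u k S ∪ evolveD n L K lv c u k T
  | 0, _, _ => rfl
  | k + 1, S, T => by
      show thickT _ c (blocks _ (evolveD n L K lv c u k (S ∪ T))) = thickT _ c _ ∪ thickT _ c _
      rw [evolveD_union u k S T, blocks, image_union, thickT_union]; rfl

/-- evolution is monotone [folklore] -/
theorem evolveD_mono (u : ℕ) : ∀ (k : ℕ) {S T : Finset (Fin d → ℕ)}, S ⊆ T →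
    evolveD n L K lv c u k S ⊆ evolveD n L K lv c u k T
  | 0, _, _, h => h
  | k + 1, _, _, h => thickT_mono _ _ (image_subset_image (evolveD_mono u k h))

/-- evolutions compose: `k′` steps from `u + k` after `k` steps from `u` are `k + k′` steps from `u` [folklore] -/
theorem evolveD_add (u k : ℕ) : ∀ (k' : ℕ) (S : Finset (Fin d → ℕ)),
    evolveD n L K lv c (u + k) k' (evolveD n L K lv c u k S) = evolveD n L K lv c u (k + k') S
  | 0, _ => rfl
  | k' + 1, S => by
      show thickT (sideD n L K lv (u + k + k' + 1)) c (blocks (L ^ (lv (u + k + k' + 1) - lv (u + k + k')))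
          (evolveD n L K lv c (u + k) k' (evolveD n L K lv c u k S))) =
        thickT (sideD n L K lv (u + (k + k') + 1)) c (blocks (L ^ (lv (u + (k + k') + 1) - lv (u + (k + k'))))
          (evolveD n L K lv c u (k + k') S))
      rw [evolveD_add u k k' S]
      simp only [Nat.add_assoc]

/-- evolution is in range of its level torus [folklore] -/
theorem inRange_evolveD (u : ℕ) {S : Finset (Fin d → ℕ)} (hS : InRange (sideD n L K lv u) S) :
    ∀ k : ℕ, InRange (sideD n L K lv (u + k)) (evolveD n L K lv c u k S)
  | 0 => hS
  | _ + 1 => inRange_thickT _ _ _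

/-- **THE LEVEL-PATTERN-FREE COLLAPSED RADIUS IS LINEAR**: `cth c 1 k = k·(c+1)` (no contraction at any step).
[folklore] -/
theorem cth_one (c : ℕ) : ∀ k : ℕ, cth c 1 k = k * (c + 1)
  | 0 => by simp [cth]
  | k + 1 => by
      show c + (cth c 1 k / 1 + 1) = (k + 1) * (c + 1)
      rw [Nat.div_one, cth_one c k]; ring

/-- **`k` LEVELLED TOLERANT STEPS COLLAPSE INTO ONE BLOCKING BY `L^{lv (u+k) − lv u}` AND ONE THICKENING BY
`cth c 1 k`** (for a level function, `L ≥ 1`, `u + k ≤ K`; a rising step contracts the accumulated radius, a plateau step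
does not — the stated radius ignores all contractions). [folklore] -/
theorem evolveD_subset_thickT_blocks (hL : 1 ≤ L) (hlv : LevelFn K lv) (u : ℕ) {S : Finset (Fin d → ℕ)}
    (hS : InRange (sideD n L K lv u) S) :
    ∀ k : ℕ, u + k ≤ K →
      evolveD n L K lv c u k S ⊆ thickT (sideD n L K lv (u + k)) (cth c 1 k) (blocks (L ^ (lv (u + k) - lv u)) S)
  | 0, _ => by
      show S ⊆ thickT (sideD n L K lv (u + 0)) 0 (blocks (L ^ (lv (u + 0) - lv u)) S)
      rw [Nat.add_zero, Nat.sub_self, pow_zero, blocks_one]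
      exact subset_thickT 0 hS
  | k + 1, hk => by
      have ih := evolveD_subset_thickT_blocks hL hlv u hS k (Nat.le_of_succ_le hk)
      set r : ℕ := L ^ (lv (u + k + 1) - lv (u + k)) with hr
      have hr1 : 1 ≤ r := Nat.one_le_pow _ _ hL
      have hsd : sideD n L K lv (u + k) = sideD n L K lv (u + k + 1) * r := sideD_add hlv (k := 1) hk
      have hSe : sideD n L K lv u = sideD n L K lv (u + k + 1) * L ^ (lv (u + k + 1) - lv u) := sideD_add hlv hk
      have hm1 : lv u ≤ lv (u + k) := hlv.monotone (Nat.le_add_right u k)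
      have hm2 : lv (u + k) ≤ lv (u + k + 1) := hlv.mono (u + k)
      have hexp : L ^ (lv (u + k) - lv u) * r = L ^ (lv (u + k + 1) - lv u) := by
        rw [hr, ← pow_add]; congr 1; omega
      have h1 : blocks r (evolveD n L K lv c u k S) ⊆
          thickT (sideD n L K lv (u + k + 1)) (cth c 1 k / r + 1) (blocks (L ^ (lv (u + k + 1) - lv u)) S) := by
        refine (image_subset_image ih).trans ?_
        rw [hsd]
        refine (blocks_thickT_subset hr1 _ _ _).trans (le_of_eq ?_)
        rw [blocks_blocks, hexp]
      have hR : InRange (sideD n L K lv (u + k + 1)) (blocks (L ^ (lv (u + k + 1) - lv u)) S) :=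
        inRange_blocks (Nat.one_le_pow _ _ hL) (by rw [← hSe]; exact hS)
      have hrad : c + (cth c 1 k / r + 1) ≤ cth c 1 (k + 1) := by
        show c + (cth c 1 k / r + 1) ≤ c + (cth c 1 k / 1 + 1)
        have := Nat.div_le_self (cth c 1 k) r
        rw [Nat.div_one]; omega
      show thickT (sideD n L K lv (u + k + 1)) c (blocks r (evolveD n L K lv c u k S)) ⊆ _
      exact ((thickT_mono _ _ h1).trans (thickT_thickT_subset c _ hR)).trans (thickT_mono_radius _ hrad _)

/-- **THE CARDINALITY OF A LEVELLED EVOLUTION**: `#evolveD u k S ≤ (2·cth c 1 k + 1)^d · #blocks (L^{lv (u+k) − lv u}) S`.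
[folklore] -/
theorem card_evolveD_le (hL : 1 ≤ L) (hlv : LevelFn K lv) (u : ℕ) {S : Finset (Fin d → ℕ)}
    (hS : InRange (sideD n L K lv u) S) {k : ℕ} (hk : u + k ≤ K) :
    (evolveD n L K lv c u k S).card ≤ (2 * cth c 1 k + 1) ^ d * (blocks (L ^ (lv (u + k) - lv u)) S).card := by
  have hSe : sideD n L K lv u = sideD n L K lv (u + k) * L ^ (lv (u + k) - lv u) := sideD_add hlv hk
  have hR : InRange (sideD n L K lv (u + k)) (blocks (L ^ (lv (u + k) - lv u)) S) :=
    inRange_blocks (Nat.one_le_pow _ _ hL) (by rw [← hSe]; exact hS)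
  exact (card_le_card (evolveD_subset_thickT_blocks hL hlv u hS k hk)).trans (card_thickT_le _ hR)

end Evolve

/-! ## §2 The ancestor decomposition of a levelled zone -/

section Parts

variable {ε : Type*} {sh : ε → PEv} {n L K c : ℕ} {lv : ℕ → ℕ} {Cb : ℝ} {G : Gen ε}
  {zone : ℕ → Gen ε → Finset (Fin d → ℕ)}

/-- a sub-structure's zone `k` steps after a step it is formed by lies in the levelled evolution of its zone then
[folklore] -/
theorem zone_subset_evolveD (hR : ZoneReadingD sh n L K lv Cb c G zone) {X : Gen ε} (hX : Sub X G) {u : ℕ}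
    (hft : ftime (PEv.step ∘ sh) X ≤ u) : ∀ k : ℕ, u + k ≤ K → zone (u + k) X ⊆ evolveD n L K lv c u k (zone u X)
  | 0, _ => subset_rfl
  | k + 1, hk => by
      have ih := zone_subset_evolveD hR hX hft k (Nat.le_of_succ_le hk)
      have hstep := hR.step X (u + k) hX (hft.trans (Nat.le_add_right u k)) hk
      show zone (u + k + 1) X ⊆ thickT (sideD n L K lv (u + k + 1)) c
        (blocks (L ^ (lv (u + k + 1) - lv (u + k))) (evolveD n L K lv c u k (zone u X)))
      exact hstep.trans (thickT_mono _ _ (image_subset_image ih))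

/-- the levelled evolution of a piece from its start, seen from a later time `s ≥ ustart p` [folklore] -/
theorem evolve_pieceD {t₀ s t : ℕ} {p : Gen ε} (hps : ustart sh t₀ p ≤ s) (hst : s ≤ t) :
    evolveD n L K lv c s (t - s)
        (evolveD n L K lv c (ustart sh t₀ p) (s - ustart sh t₀ p) (zone (ustart sh t₀ p) p)) =
      evolveD n L K lv c (ustart sh t₀ p) (t - ustart sh t₀ p) (zone (ustart sh t₀ p) p) := by
  have h := evolveD_add (n := n) (L := L) (K := K) (lv := lv) (c := c) (ustart sh t₀ p) (s - ustart sh t₀ p)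
    (t - s) (zone (ustart sh t₀ p) p)
  rw [Nat.add_sub_cancel' hps] at h
  rw [h, show s - ustart sh t₀ p + (t - s) = t - ustart sh t₀ p by omega]

variable [DecidableEq ε]

/-- **THE ANCESTOR DECOMPOSITION AT LEVELS**: for a chronological levelled reading, a sub-structure `X` formed by
`t ≤ K`, and a cut `t₀ ≤ t + 1`: `zone t X` lies in the union over the pieces `p ∈ parts t₀ X` of the levelled
evolutions of `zone (ustart p) p` from `ustart p` to `t`. [folklore] -/
theorem zone_subset_partsD (hR : ZoneReadingD sh n L K lv Cb c G zone) (hchr : Chrono (PEv.step ∘ sh) G) (t₀ : ℕ) :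
    ∀ {X : Gen ε}, Sub X G → ∀ {t : ℕ}, t₀ ≤ t + 1 → ftime (PEv.step ∘ sh) X ≤ t → t ≤ K →
      zone t X ⊆ lunion ((parts sh t₀ X).map fun p =>
        evolveD n L K lv c (ustart sh t₀ p) (t - ustart sh t₀ p) (zone (ustart sh t₀ p) p))
  | Gen.born b j, hX, t, ht₀, hft, htK => by
      simp only [parts, List.map_cons, List.map_nil, lunion, union_empty]
      have hfu : ftime (PEv.step ∘ sh) (Gen.born b j) ≤ ustart sh t₀ (Gen.born b j) := le_max_right _ _
      have hut : ustart sh t₀ (Gen.born b j) ≤ t := max_le (by omega) hft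
      have h := zone_subset_evolveD hR hX hfu (t - ustart sh t₀ (Gen.born b j)) (by omega)
      rwa [Nat.add_sub_cancel' hut] at h
  | Gen.renew Y e h, hX, t, ht₀, hft, htK => by
      have hY : Sub Y G := Sub.trans (Sub.renew e h (Sub.refl Y)) hX
      exact (hR.renew Y e h t hX).trans (zone_subset_partsD hR hchr t₀ hY ht₀ hft htK)
  | Gen.merge Y Z e, hX, t, ht₀, hft, htK => by
      by_cases hlt : (sh e).step < t₀
      · -- an ancestor: evolve its own zone from `t₀ − 1`
        simp only [parts, if_pos hlt, List.map_cons, List.map_nil, lunion, union_empty]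
        have hfu : ftime (PEv.step ∘ sh) (Gen.merge Y Z e) ≤ ustart sh t₀ (Gen.merge Y Z e) := le_max_right _ _
        have hut : ustart sh t₀ (Gen.merge Y Z e) ≤ t := max_le (by omega) hft
        have h := zone_subset_evolveD hR hX hfu (t - ustart sh t₀ (Gen.merge Y Z e)) (by omega)
        rwa [Nat.add_sub_cancel' hut] at h
      · -- a recent merger: evolve from the merger step, then decompose the partners there
        simp only [parts, if_neg hlt, List.map_append]
        have hfte : ftime (PEv.step ∘ sh) (Gen.merge Y Z e) = (sh e).step := rfl
        rw [hfte] at hft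
        have hchrX := chrono_of_sub (PEv.step ∘ sh) hX hchr
        obtain ⟨hfY, hfZ⟩ := ftime_le_of_chrono (PEv.step ∘ sh) hchrX
        have hY : Sub Y G := Sub.trans (Sub.left Z e (Sub.refl Y)) hX
        have hZ : Sub Z G := Sub.trans (Sub.right Y e (Sub.refl Z)) hX
        have hsK : (sh e).step ≤ K := hft.trans htK
        have ht₀s : t₀ ≤ (sh e).step + 1 := by omega
        have hdY := zone_subset_partsD hR hchr t₀ hY ht₀s hfY hsK
        have hdZ := zone_subset_partsD hR hchr t₀ hZ ht₀s hfZ hsK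
        have h0 := zone_subset_evolveD hR hX (u := (sh e).step) le_rfl (t - (sh e).step) (by omega)
        rw [Nat.add_sub_cancel' hft] at h0
        have h1 := h0.trans (evolveD_mono (sh e).step (t - (sh e).step) (hR.union Y Z e hX))
        rw [evolveD_union] at h1
        -- pushing the evolution through a decomposition at the merger step
        have push : ∀ {W : Gen ε}, Sub W G → ftime (PEv.step ∘ sh) W ≤ (sh e).step → ∀ l : List (Gen ε),
            (∀ p ∈ l, p ∈ parts sh t₀ W) →
            evolveD n L K lv c (sh e).step (t - (sh e).step) (lunion (l.map fun p =>
              evolveD n L K lv c (ustart sh t₀ p) ((sh e).step - ustart sh t₀ p) (zone (ustart sh t₀ p) p))) ⊆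
            lunion (l.map fun p =>
              evolveD n L K lv c (ustart sh t₀ p) (t - ustart sh t₀ p) (zone (ustart sh t₀ p) p)) := by
          intro W hW hfW l hl
          induction l with
          | nil => simp [lunion, evolveD_empty]
          | cons p l ihl =>
              simp only [List.map_cons, lunion]
              rw [evolveD_union]
              refine union_subset_union (le_of_eq ?_) (ihl fun q hq => hl q (List.mem_cons_of_mem _ hq))
              have hp := hl p List.mem_cons_self
              have hup : ustart sh t₀ p ≤ (sh e).step :=
                max_le (by omega) ((ftime_le_of_sub _ (sub_of_mem_parts t₀ hp)
                  (chrono_of_sub (PEv.step ∘ sh) hW hchr)).trans hfW)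
              exact evolve_pieceD hup hft
        intro z hz
        rw [mem_lunion]
        rcases mem_union.1 (h1 hz) with h | h
        · have h' := push hY hfY _ (fun p hp => hp) (evolveD_mono _ _ hdY h)
          obtain ⟨S, hS, hzS⟩ := mem_lunion.1 h'
          exact ⟨S, List.mem_append.2 (Or.inl hS), hzS⟩
        · have h' := push hZ hfZ _ (fun p hp => hp) (evolveD_mono _ _ hdZ h)
          obtain ⟨S, hS, hzS⟩ := mem_lunion.1 h'
          exact ⟨S, List.mem_append.2 (Or.inr hS), hzS⟩

end Parts

/-! ## §3 Sanity (decided) -/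

namespace Sanity

/-- the level-pattern-free collapsed radii for `c = 2`: `0, 3, 6, 9` (no contraction; `cth_one`) -/
example : (List.range 4).map (cth 2 1) = [0, 3, 6, 9] := by decide

/-- on a drop-free life (`lv = id`) two levelled steps from `u = 0` on `(ℤ∕8)¹` (`n = 1`, `L = 2`, `K = 3`, `c = 0`) act
as two plain blockings by `2`: the cell `5` goes to `2`, then to `1` (decided) -/
example : evolveD 1 2 3 (fun t => t) 0 0 2 ({![5]} : Finset (Fin 1 → ℕ)) = {![1]} := by decide

end Sanity

end

end Summit.QuantumFields.BalabanUV.T4Continuum.HistoryZoneEvolveLevels
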